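import Summits.ResolutionOfSingularities.ResolutionOfSingularities.Theorems.MarkedTransferCampaignW46HostSurfaces
import Summits.ResolutionOfSingularities.ResolutionOfSingularities.Theorems.MarkedTransferCampaignW46ThreefoldsHostSmooth
import HarnessLib

/-!
# [OURS · L1 W4.6 rung (i)/(ii), host words] SMOOTH PULL-BACKS OF SURFACE INPUTS — every cylinder over a surface input of the host
# item has a BGMW marked resolution WITH ITS PULLED-BACK SNC BOUNDARY (rung `d = 2` ∘ smooth transfer)

Cell res-hironaka, LADDER-RESOLUTION rung L (D-0089), slot W4.6; seat res-L1-s46-pv-1 (gen 6). Host route MarkedTransfer, host item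
`HypersurfaceOrderReductionDimLeThree` (stmt-ResolutionOfSingularities-16156); filed `--kind proof --supports` it `--as helper`. The corollary
announced in res-L1-s46-pv-3's `…ThreefoldsHostSmooth.lean` (p505483, §3: «with `d = 2` every cylinder over a surface input will be») now
that the surface rung of the host ladder is a kernel theorem (`hypersurfaceOrderReductionDimLE_two`, `…HostSurfaces.lean`). Everything
here is OURS; nothing is a statement of H. Hironaka's manuscript [Hironaka2017]; no typed candidate, no named FACT. AI-written; AI review
is weaker than expert review. Host-words counterpart of pv-3's Γ-free `…GammaFreeGlobalCylinders.lean` (p529073).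

## What is proved (no definitions; universe `0`, the universe of the host item)

* `exists_isMarkedResolution_of_smooth_over_surface` — for `p` prime, `k` perfect of characteristic `p`, `S` a separated quasi-compact
  integral regular `k`-scheme locally of finite type of dimension `≤ 2`, `I ≠ 0` effective Cartier on `S`, `E` an snc boundary on `S`,
  `φ : X′ ⟶ S` SMOOTH (any `X′`, any dimension) and `m ≥ 1`: the marked ideal `(X′, φ^*I, φ^*E, m)` has a BGMW marked resolution.
* `exists_isMarkedResolution_fst_of_surface` — the product form on `S ×_k Y` for every smooth `Y → Spec k` (threefolds `S ×_k C` over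
  smooth curves, `S ×_k 𝔸ⁿ_k`, …): a family of GENUINE `d = 3` inputs of stmt-16156 (with non-empty boundary) settled in its own words.

## Sources

* E. Bierstone, D. Grigoriev, P. Milman, J. Włodarczyk, arXiv:1206.3090, Thm. 8.0.5 (functoriality w.r.t. smooth morphisms).
  [BierstoneGrigorievMilmanWlodarczyk2011]
* H. Hironaka, ms. 2017-03-23 — scope only, under adjudication, not cited as fact. [Hironaka2017]
-/

noncomputable section

set_option linter.dupNamespace false -- mandated namespace of this single-conjunct summit

open CategoryTheory CategoryTheory.Limits AlgebraicGeometry TopologicalSpace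

namespace Summit.ResolutionOfSingularities.ResolutionOfSingularities.Theorems

namespace CampaignW46

open Literature.AlgebraicGeometry.Resolution

/-- **SMOOTH PULL-BACKS OF SURFACE INPUTS OF THE HOST ITEM HAVE MARKED RESOLUTIONS** (any dimension upstairs): rung `d = 2` of the
host ladder (`hypersurfaceOrderReductionDimLE_two`) through res-L1-s46-pv-3's transfer principle `hostConclusion_of_smooth_over_rung`.
[cite: BierstoneGrigorievMilmanWlodarczyk2011, Thm. 8.0.5] -/
theorem exists_isMarkedResolution_of_smooth_over_surface {p : ℕ} (hp : p.Prime) (k : Type) [Field k] [CharP k p]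
    [PerfectField k] (S : Scheme.{0}) (s : S ⟶ Spec (.of k)) (hsep : IsSeparated s) (hloft : LocallyOfFiniteType s)
    (hqc : QuasiCompact s) (hint : IsIntegral S) (hreg : Scheme.IsRegular S) (hdim : topologicalKrullDim S ≤ 2)
    (I : S.IdealSheafData) (hI : I ≠ ⊥) (hIc : IsEffectiveCartier I) (E : List S.IdealSheafData) (hE : HasSNC E)
    {X' : Scheme.{0}} (φ : X' ⟶ S) [Smooth φ] {m : ℕ} (hm : 1 ≤ m) :
    ∃ (X₁' : Scheme.{0}) (Φ' : X₁' ⟶ X') (M'' : MarkedIdeal X₁'),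
      IsMarkedResolution (⟨I.comap φ, E.map (·.comap φ), m⟩ : MarkedIdeal X') Φ' M'' :=
  hostConclusion_of_smooth_over_rung (hypersurfaceOrderReductionDimLE_two p) hp k S s hsep hloft hqc hint hreg
    (by exact_mod_cast hdim) I hI hIc E hE φ hm

/-- **PRODUCT FORM**: for a surface input `(S, I, E)` as above and ANY smooth `t : Y ⟶ Spec k`, the marked ideal
`(S ×_k Y, pr₁^*I, pr₁^*E, m)` has a BGMW marked resolution for every `m ≥ 1` (the first projection is smooth: base change of `t`).
[cite: BierstoneGrigorievMilmanWlodarczyk2011, Thm. 8.0.5] -/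
theorem exists_isMarkedResolution_fst_of_surface {p : ℕ} (hp : p.Prime) (k : Type) [Field k] [CharP k p]
    [PerfectField k] (S : Scheme.{0}) (s : S ⟶ Spec (.of k)) (hsep : IsSeparated s) (hloft : LocallyOfFiniteType s)
    (hqc : QuasiCompact s) (hint : IsIntegral S) (hreg : Scheme.IsRegular S) (hdim : topologicalKrullDim S ≤ 2)
    (I : S.IdealSheafData) (hI : I ≠ ⊥) (hIc : IsEffectiveCartier I) (E : List S.IdealSheafData) (hE : HasSNC E)
    {Y : Scheme.{0}} (t : Y ⟶ Spec (.of k)) [Smooth t] {m : ℕ} (hm : 1 ≤ m) :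
    ∃ (X₁' : Scheme.{0}) (Φ' : X₁' ⟶ pullback s t) (M'' : MarkedIdeal X₁'),
      IsMarkedResolution (⟨I.comap (pullback.fst s t), E.map (·.comap (pullback.fst s t)), m⟩ : MarkedIdeal (pullback s t)) Φ' M'' := by
  haveI : Smooth (pullback.fst s t) := MorphismProperty.pullback_fst _ _ inferInstance
  exact exists_isMarkedResolution_of_smooth_over_surface hp k S s hsep hloft hqc hint hreg hdim I hI hIc E hE _ hm

end CampaignW46

end Summit.ResolutionOfSingularities.ResolutionOfSingularities.Theorems

end
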